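import Mathlib
import Literature.NumberTheory.LFunctions.Zhang2022.Section7aStatements
import Literature.NumberTheory.LFunctions.Zhang2022.Section7bDischarges
import HarnessLib

/-!
# Zhang (2022) §7, proof of Proposition 7.1: the step "(7.3) ⇒ (7.6)" — DISCHARGED as a kernel edge

Topic `Literature/NumberTheory/LFunctions/Zhang2022` (Landau–Siegel audit tree; verdict-neutral).
Y. Zhang, *Discrete mean estimates and the Landau–Siegel zero*, arXiv:2211.02515v1 (2022)
[Zhang2022LandauSiegel] — **an unrefereed manuscript under adjudication**. D-0069 campaign, cell
`siegel-zhang`, layer L2, cone leaf C18 (`Skeleton.Ded71`). The display (7.6) (§7 p. 37, tex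
L1912–L1919): "By (7.3) we may write
`Θ₁ = −i Σ_{p∼P} (pt₀)^{β₃} Σ*_{ψ (mod p)} I₁(ψ) + o(𝔓)` (7.6), where
`I₁(ψ) = (1/2πi)∫_{𝔍(1)} Z(s,ψ)⁻¹ (Σ_m (κ∗a₁)(m)ψ(m)m^{−s}) A(𝐚₂;1−s,ψ̄)ω(s) ds`."

Typed nodes: (7.3) = `Section7aStatements.Eq73` (slice L2-t2), (7.6) = `Section7bStatements.Eq76`
(slice L2-t3), `I₁(ψ)` = `Section7bStatements.I1psi`, `Σ*_{ψ (mod p)}` = `Section7bStatements.sumPrimAt`.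
This file PROVES the implication `eq76_of_eq73 : Eq73 c′ → Eq76 c′` (theorems only; 0 new
definitions; 0 new facts). The bookkeeping the text leaves implicit: `Θ₁` is the sum over `Ψ₁` of
`(1/2πi)∫_{𝔍(1)} 𝒞(s,ψ)A(𝐚₁;s,ψ)A(𝐚₂;1−s,ψ̄)ω(s)ds` (`Skeleton.Theta1`); `Ψ₁ = Ψ ∖ Ψ₂` with `Ψ`
finite, so `Θ₁ = Σ_{ψ∈Ψ} − Σ_{ψ∈Ψ₂}`, the second sum being `o(𝔓)` by (7.3); on `𝔍(1)` the integrand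
equals `−i(pt₀)^{β₃}` times the integrand of `I₁(ψ)` by the display of tex L1874
(`Z22:§7.u014`, a THEOREM of the tree: `Section7aStatements.step7u014_holds`, with the two typings of
`κ ∗ a₁` identified by `Section7bStatements.kappaConv_eq_conv`); and the sum over `Ψ` is regrouped by
the modulus `p ∼ P`.

WHAT THIS IS NOT: any claim about Theorems 1–2 of the manuscript or about Landau–Siegel zeros; not a
proof of (7.3) or (7.6) themselves — only of the printed inference between them.

## References

* Y. Zhang, arXiv:2211.02515v1 (2022), §7 (7.3) p. 34 tex L1860, (7.6) p. 37 tex L1912–L1919,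
  and the display tex L1874. [cite: Zhang2022LandauSiegel, §7 (7.6) p.37]
-/

noncomputable section

open Complex Finset Real

namespace Literature.NumberTheory.LFunctions.Zhang2022.Section7bStatements

open Literature.NumberTheory.LFunctions.Zhang2022.Skeleton

/-! ## Finite-sum bookkeeping over `Ψ` -/

/-- For a set of characters `S ⊆ Ψ` (`Ψ` is finite), `finsetOf S` is the filter of the universe by
membership in `S`. [cite: Zhang2022LandauSiegel, §2 (2.16) p.5] -/
theorem finsetOf_eq_filter {D : ℕ} [Fintype (Chr D)] (S : Set (Chr D)) [DecidablePred (· ∈ S)] :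
    finsetOf S = Finset.univ.filter (· ∈ S) := by
  ext x
  rw [mem_finsetOf (Set.toFinite S), Finset.mem_filter]
  simp

/-- `Σ_{ψ∈Ψ₁} f(ψ) + Σ_{ψ∈Ψ₂} f(ψ) = Σ_{ψ∈Ψ} f(ψ)` (`Ψ₂` is the complement of `Ψ₁` in `Ψ`).
[cite: Zhang2022LandauSiegel, §2 Prop. 2.1 p.4] -/
theorem sum_PsiOne_add_sum_PsiTwo {D : ℕ} [NeZero D] [Fintype (Chr D)]
    (χ : DirichletCharacter ℂ D) (f : Chr D → ℂ) :
    ∑ x ∈ finsetOf (PsiOne χ), f x + ∑ x ∈ finsetOf (PsiTwo χ), f x = ∑ x : Chr D, f x := by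
  classical
  rw [finsetOf_eq_filter (PsiOne χ), finsetOf_eq_filter (PsiTwo χ)]
  have h : Finset.univ.filter (· ∈ PsiTwo χ) = Finset.univ.filter (fun x => ¬ x ∈ PsiOne χ) := by
    ext x
    simp [PsiTwo]
  rw [h]
  exact Finset.sum_filter_add_sum_filter_not _ _ _

/-- Regrouping a sum over `Ψ` by the modulus: `Σ_{ψ∈Ψ} g(ψ) = Σ_{p∼P} Σ*_{ψ (mod p)} g(ψ)`.
[cite: Zhang2022LandauSiegel, §2 p.3, tex L290–L295] -/
theorem sum_univ_eq_sum_primeWindow_sumPrimAt {D : ℕ} [Fintype (Chr D)] (g : Chr D → ℂ) :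
    ∑ x : Chr D, g x = ∑ p ∈ primeWindow D, sumPrimAt D p g := by
  classical
  have h : ∀ p : ℕ, sumPrimAt D p g = ∑ x ∈ Finset.univ.filter (fun x : Chr D => x.p = p), g x := by
    intro p
    rw [sumPrimAt, finsetOf_eq_filter]
    rfl
  simp_rw [h]
  exact (Finset.sum_fiberwise_of_maps_to (fun x _ => x.mem) g).symm

/-- Inside `Σ*_{ψ (mod p)}` the modulus is `p`: a factor depending only on the modulus comes out.
[cite: Zhang2022LandauSiegel, §7 (7.6) p.37] -/
theorem sumPrimAt_modulus_mul {D : ℕ} (p : ℕ) (c : ℕ → ℂ) (g : Chr D → ℂ) :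
    sumPrimAt D p (fun x => c x.p * g x) = c p * sumPrimAt D p g := by
  classical
  haveI : Fintype (Chr D) := Fintype.ofFinite _
  rw [sumPrimAt, sumPrimAt, finsetOf_eq_filter, Finset.mul_sum]
  refine Finset.sum_congr rfl fun x hx => ?_
  rw [Finset.mem_filter] at hx
  have : x.p = p := hx.2
  rw [this]

/-! ## The integrand of `Θ₁` on `𝔍(1)` is `−i(pt₀)^{β₃}` times the integrand of `I₁(ψ)` -/

/-- The points of the path of `segInt … 1` lie on `𝔍(1)`. [cite: Zhang2022LandauSiegel, §7 p.33, tex L1824] -/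
theorem segPoint_one_mem_segJ {D : ℕ} {v : ℝ} (hv : |v| ≤ ell1 D) :
    (1 : ℂ) + SmoothWeight.s0 (t0 D) + v * I ∈ Section7aStatements.segJ D 1 := by
  rw [Section7aStatements.segJ, Set.mem_setOf_eq]
  have hre : ((1 : ℂ) + SmoothWeight.s0 (t0 D) + v * I).re = 1 / 2 + 1 := by
    simp [SmoothWeight.s0]; norm_num
  have him : ((1 : ℂ) + SmoothWeight.s0 (t0 D) + v * I).im - 2 * π * t0 D = v := by
    simp [SmoothWeight.s0]
  exact ⟨hre, by rw [him]; exact hv⟩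

/-- For `ψ ∈ Ψ` and `𝐚₁` satisfying (7.2):
`(1/2πi)∫_{𝔍(1)} 𝒞(s,ψ)A(𝐚₁;s,ψ)A(𝐚₂;1−s,ψ̄)ω(s)ds = −i(pt₀)^{β₃} I₁(ψ)`
(from `𝒞(s,ψ)A(𝐚₁;s,ψ) = −i(pt₀)^{β₃}Z(s,ψ)⁻¹Σ_m(κ∗a₁)(m)ψ(m)m^{−s}` on `𝔍(1)`, tex L1874, the tree's
`Section7aStatements.step7u014_holds`). [cite: Zhang2022LandauSiegel, §7 (7.6) p.37, tex L1917] -/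
theorem segInt_mvIntegrand_eq (c' : ℝ) {D : ℕ} (x : Chr D) {B : ℝ} {a₁ : ℕ → ℂ}
    (ha₁ : Adm72 D B a₁) (a₂ : ℕ → ℂ) :
    Lemma81.segInt (t0 D) (ell1 D) 1 (Section7aStatements.mvIntegrand c' x a₁ a₂) =
      -I * (((x.p : ℝ) * t0 D : ℝ) : ℂ) ^ beta3 c' D * I1psi c' x a₁ a₂ := by
  have hkc : Section7aStatements.kconv c' D a₁ = kappaConv c' D a₁ := by
    rw [kappaConv_eq_conv]; rfl
  have hpt : ∀ v ∈ Set.uIcc (-ell1 D) (ell1 D),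
      Section7aStatements.mvIntegrand c' x a₁ a₂ ((1 : ℂ) + SmoothWeight.s0 (t0 D) + v * I) =
        -I * (((x.p : ℝ) * t0 D : ℝ) : ℂ) ^ beta3 c' D *
          ((GammaFactor.Zfac x.ψ ((1 : ℂ) + SmoothWeight.s0 (t0 D) + v * I))⁻¹ *
            LSeries (fun m => kappaConv c' D a₁ m * x.ψ (m : ZMod x.p))
              ((1 : ℂ) + SmoothWeight.s0 (t0 D) + v * I) *
            ApolyBar x a₂ (1 - ((1 : ℂ) + SmoothWeight.s0 (t0 D) + v * I)) *
            omegaW D ((1 : ℂ) + SmoothWeight.s0 (t0 D) + v * I)) := by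
    intro v hv
    have hℓ : 0 ≤ ell1 D := by
      rw [ell1]; exact pow_nonneg (Real.log_natCast_nonneg D) _
    rw [Set.uIcc_of_le (by linarith), Set.mem_Icc] at hv
    have habs : |v| ≤ ell1 D := abs_le.mpr ⟨hv.1, hv.2⟩
    have h14 := Section7aStatements.step7u014_holds c' D x B a₁ ha₁ _ (segPoint_one_mem_segJ habs)
    have hser : Section7aStatements.kconvSeries c' x a₁ ((1 : ℂ) + SmoothWeight.s0 (t0 D) + v * I) =
        LSeries (fun m => kappaConv c' D a₁ m * x.ψ (m : ZMod x.p))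
          ((1 : ℂ) + SmoothWeight.s0 (t0 D) + v * I) := by
      rw [Section7aStatements.kconvSeries, hkc]
    unfold Section7aStatements.mvIntegrand
    rw [h14, hser]
    ring
  rw [I1psi, Lemma81.segInt, Lemma81.segInt, intervalIntegral.integral_congr hpt,
    intervalIntegral.integral_const_mul]
  ring

/-! ## (7.3) ⇒ (7.6) -/

/-- **The edge (7.3) ⇒ (7.6) holds** (`Eq73 c′ → Eq76 c′`): "By (7.3) we may write
`Θ₁ = −iΣ_{p∼P}(pt₀)^{β₃}Σ*_{ψ(mod p)}I₁(ψ) + o(𝔓)` (7.6)" (§7 p. 37). Proof: `Θ₁` (a sum over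
`Ψ₁`) equals the same sum over all of `Ψ` minus the sum over `Ψ₂`; the latter is `(1/2πi)` times the
sum bounded in (7.3), hence `≤ ε𝔓/(2π) ≤ ε𝔓`; the former is, term by term, `−i(pt₀)^{β₃}I₁(ψ)`
(`segInt_mvIntegrand_eq`), regrouped by the modulus `p ∼ P`.
[cite: Zhang2022LandauSiegel, §7 (7.6) p.37, tex L1912–L1919] -/
theorem eq76_of_eq73 (c' : ℝ) (h73 : Section7aStatements.Eq73 c') : Eq76 c' := by
  intro B ε hε
  refine (h73 B ε hε).mono ?_
  intro D _ χ _ _ h hA a₁ a₂ ha₁ ha₂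
  have h3 := h hA a₁ a₂ ha₁ ha₂
  classical
  haveI : Fintype (Chr D) := Fintype.ofFinite _
  -- `Θ₁` as the sum over `Ψ₁` of the segment integrals of the integrand of (7.3)
  have hTheta : Theta1 c' χ a₁ a₂ =
      ∑ x ∈ finsetOf (PsiOne χ),
        Lemma81.segInt (t0 D) (ell1 D) 1 (Section7aStatements.mvIntegrand c' x a₁ a₂) := rfl
  -- the sum over all of `Ψ`, regrouped by modulus
  have hall : ∑ x : Chr D,
      Lemma81.segInt (t0 D) (ell1 D) 1 (Section7aStatements.mvIntegrand c' x a₁ a₂) =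
        -I * ∑ p ∈ primeWindow D, (((p : ℝ) * t0 D : ℝ) : ℂ) ^ beta3 c' D *
          sumPrimAt D p (fun x => I1psi c' x a₁ a₂) := by
    have h1 : (fun x : Chr D =>
        Lemma81.segInt (t0 D) (ell1 D) 1 (Section7aStatements.mvIntegrand c' x a₁ a₂)) =
          fun x => -I * (((x.p : ℝ) * t0 D : ℝ) : ℂ) ^ beta3 c' D * I1psi c' x a₁ a₂ :=
      funext fun x => segInt_mvIntegrand_eq c' x ha₁ a₂
    rw [sum_univ_eq_sum_primeWindow_sumPrimAt, Finset.mul_sum, h1]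
    refine Finset.sum_congr rfl fun p _ => ?_
    have h2 := sumPrimAt_modulus_mul (D := D) p
      (fun q : ℕ => -I * (((q : ℝ) * t0 D : ℝ) : ℂ) ^ beta3 c' D) (fun x => I1psi c' x a₁ a₂)
    beta_reduce at h2
    rw [h2]
    ring
  -- the sum over `Ψ₂` is `(1/2πi)` times the sum of (7.3)
  have htwo : ∑ x ∈ finsetOf (PsiTwo χ),
      Section7aStatements.intJ D 1 (Section7aStatements.mvIntegrand c' x a₁ a₂) =
        2 * π * I * ∑ x ∈ finsetOf (PsiTwo χ),
          Lemma81.segInt (t0 D) (ell1 D) 1 (Section7aStatements.mvIntegrand c' x a₁ a₂) := by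
    rw [Finset.mul_sum]
    rfl
  have hsplit := sum_PsiOne_add_sum_PsiTwo χ
    (fun x => Lemma81.segInt (t0 D) (ell1 D) 1 (Section7aStatements.mvIntegrand c' x a₁ a₂))
  have key : Theta1 c' χ a₁ a₂ -
      -I * ∑ p ∈ primeWindow D, (((p : ℝ) * t0 D : ℝ) : ℂ) ^ beta3 c' D *
        sumPrimAt D p (fun x => I1psi c' x a₁ a₂) =
      -∑ x ∈ finsetOf (PsiTwo χ),
        Lemma81.segInt (t0 D) (ell1 D) 1 (Section7aStatements.mvIntegrand c' x a₁ a₂) := by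
    rw [hTheta, ← hall, ← hsplit]
    ring
  rw [key, norm_neg]
  -- norm bookkeeping: `‖Σ segInt‖ = ‖Σ intJ‖/(2π) ≤ ε𝔓/(2π) ≤ ε𝔓`
  have h2π : ‖(2 * π * I : ℂ)‖ = 2 * π := by
    simp [abs_of_pos Real.pi_pos]
  have hnorm : ‖∑ x ∈ finsetOf (PsiTwo χ),
      Lemma81.segInt (t0 D) (ell1 D) 1 (Section7aStatements.mvIntegrand c' x a₁ a₂)‖ =
      ‖∑ x ∈ finsetOf (PsiTwo χ),
        Section7aStatements.intJ D 1 (Section7aStatements.mvIntegrand c' x a₁ a₂)‖ / (2 * π) := by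
    rw [htwo, norm_mul, h2π]
    field_simp
  rw [hnorm]
  have hP : 0 ≤ ε * frakP D := mul_nonneg hε.le (frakP_nonneg D)
  have hπ1 : (1 : ℝ) ≤ 2 * π := by linarith [Real.pi_gt_three]
  calc ‖∑ x ∈ finsetOf (PsiTwo χ),
          Section7aStatements.intJ D 1 (Section7aStatements.mvIntegrand c' x a₁ a₂)‖ / (2 * π)
      ≤ ε * frakP D / (2 * π) := div_le_div_of_nonneg_right h3 (by positivity)
    _ ≤ ε * frakP D := div_le_self hP hπ1

end Literature.NumberTheory.LFunctions.Zhang2022.Section7bStatements
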